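import Mathlib.Algebra.Category.ModuleCat.Projective
import Literature.AlgebraicGeometry.Motives.EtaleCohomologicalDimension
import Literature.AlgebraicGeometry.Motives.LinearSheafCohomology
import HarnessLib

/-!
# The `R`-linear étale cohomology of a geometric point vanishes

The tree's `EtaleCohomologyPoint.lean` / `EtaleCohomologicalDimension.lean` prove, for
**abelian** sheaves and Mathlib's `Sheaf.H`, that the small étale site of `Spec K`, `K` separably
closed, is cohomologically trivial, and register that it is a **local site**
(`isLocalSite_smallEtaleTopology_Spec`: the only covering sieve of the final object `Spec K` is
the maximal one, from Mathlib's `Scheme.exists_fac_of_etale_of_isSepClosed`). This file records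
the counterpart for sheaves of **`R`-modules** and the `R`-linear cohomology
`linearCohomology` / `etaleModCohomology` of `LinearSheafCohomology.lean` (the coefficient
categories of the `ℓ`-adic tower with its cup products), in three lines from Mathlib's local-site
API (`GrothendieckTopology.IsLocalSite`: `Γ ⊣ coconstantSheaf`, so `Γ` is a left adjoint):

* `preservesEpimorphisms_Γ_point`: `Γ(Spec K, –) : Sh((Spec K)_et, R) → Mod_R` preserves
  epimorphisms;
* `projective_constantSheafSelf_point`: the constant sheaf `R` is projective (left-adjoint image,
  under `constantSheaf ⊣ Γ`, of the projective `R`-module `R`; Mathlib `Adjunction.map_projective`);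
* `linearCohomology_point_eq_zero`, `etaleModCohomology_point_eq_zero`:
  **`Hⁿ((Spec K)_ét, F) = 0` for all `n ≥ 1` and all sheaves of `R`-modules `F`**, in particular
  `Hⁿ((Spec K)_ét, R) = 0` (Milne III Example 1.7 (a): `Hⁱ(Spec K, F) = Hⁱ(G, M)` is Galois
  cohomology of `G = Gal(K_sep/K)`, trivial here; II Thm. 1.9 / II §2: `S(x̄_et) ≈ Ab`);
* `etaleModCohomologyZeroPointAddEquiv` (+ `_one`): **`H⁰((Spec K)_ét, R) ≃ R`**, `1 ↦ 1`
  (constant sheaves are fully faithful on a local site, Mathlib `fullyFaithfulConstantSheaf`).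

## References

* J. S. Milne, *Étale cohomology* (reissue 2025; `book:milne2025-etale-cohomology`): II Thm. 1.9
  (PDF p. 61), II §2 (p. 67: `S(x̄_et) ≈ Ab`), III Example 1.7 (a) (p. 95). [Milne2025]
* Mathlib: `GrothendieckTopology.IsLocalSite` (`Γ_isLeftAdjoint`, `constantSheafΓAdj`),
  `Adjunction.map_projective`, `Abelian.Ext.eq_zero_of_projective`.

## Design notes

* Following the convention of `EtaleCohomologyPoint.lean`, the `Prop`-valued class facts
  (`PreservesEpimorphisms`, `Projective`) are theorems installed locally with `haveI`; only the
  `Subsingleton` instances on the cohomology groups are global.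
-/

universe u

open CategoryTheory CategoryTheory.Limits AlgebraicGeometry Opposite CategoryTheory.Abelian

namespace Literature.AlgebraicGeometry.Motives

variable (K : Type u) [Field K] [IsSepClosed K] (R : Type u) [CommRing R]

/-- **`Γ(Spec K, –)` preserves epimorphisms** on sheaves of `R`-modules on `(Spec K)_et`
(`K` separably closed): on the local site `(Spec K)_et` the global sections functor is a left
adjoint (Mathlib `IsLocalSite.Γ_isLeftAdjoint`). [cite: Milne2025, II Theorem 1.9] -/
theorem preservesEpimorphisms_Γ_point :
    (Sheaf.Γ (Spec (CommRingCat.of K)).smallEtaleTopology (ModuleCat.{u} R)).PreservesEpimorphisms :=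
  inferInstance

/-- **The constant sheaf `R` on `(Spec K)_et` is projective** (`K` separably closed): the image
of the projective `R`-module `R` under the left adjoint `constantSheaf ⊣ Γ` of an
epimorphism-preserving functor (Mathlib `Adjunction.map_projective`). [cite: Milne2025, II Theorem 1.9] -/
theorem projective_constantSheafSelf_point :
    Projective (constantSheafSelf (Spec (CommRingCat.of K)).smallEtaleTopology R) :=
  haveI := preservesEpimorphisms_Γ_point K R
  (constantSheafΓAdj (Spec (CommRingCat.of K)).smallEtaleTopology (ModuleCat.{u} R)).map_projective
    _ ((IsProjective.iff_projective (R := R) (P := R)).1 inferInstance)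

/-- **`Hⁿ((Spec K)_ét, F) = 0` for all `n ≥ 1` and every sheaf of `R`-modules `F`** (`K`
separably closed): `Hⁿ = Extⁿ(R, F)` and `R` is projective (Milne III Example 1.7 (a):
`Hⁱ(Spec K, F) = Hⁱ(G, M)` is the Galois cohomology of `G = Gal(K_sep/K)`, trivial here).
[cite: Milne2025, III Example 1.7 (a)] -/
theorem linearCohomology_point_eq_zero
    (F : Sheaf (Spec (CommRingCat.of K)).smallEtaleTopology (ModuleCat.{u} R)) (n : ℕ)
    (x : linearCohomology R F (n + 1)) : x = 0 := by
  haveI := projective_constantSheafSelf_point K R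
  exact Abelian.Ext.eq_zero_of_projective x

/-- `Hⁿ((Spec K)_ét, F)` is trivial for `n ≥ 1`. [folklore] -/
instance subsingleton_linearCohomology_point
    (F : Sheaf (Spec (CommRingCat.of K)).smallEtaleTopology (ModuleCat.{u} R)) (n : ℕ) :
    Subsingleton (linearCohomology R F (n + 1)) :=
  subsingleton_of_forall_eq 0 (linearCohomology_point_eq_zero K R F n)

/-- **`Hⁿ((Spec K)_ét, R) = 0` for `n ≥ 1`** (the `R`-linear étale cohomology with its cup
product, `etaleModCohomology`, of a geometric point). [cite: Milne2025, III Example 1.7 (a)] -/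
theorem etaleModCohomology_point_eq_zero (n : ℕ)
    (x : etaleModCohomology (Spec (CommRingCat.of K)) R (n + 1)) : x = 0 :=
  linearCohomology_point_eq_zero K R _ n x

/-- `Hⁿ((Spec K)_ét, R)` is trivial for `n ≥ 1`. [folklore] -/
instance subsingleton_etaleModCohomology_point (n : ℕ) :
    Subsingleton (etaleModCohomology (Spec (CommRingCat.of K)) R (n + 1)) :=
  subsingleton_linearCohomology_point K R _ n

/-! ### `H⁰((Spec K)_ét, R) = R` -/

/-- On the local site `(Spec K)_et` the constant sheaf functor is fully faithful (Mathlib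
`IsLocalSite.fullyFaithfulConstantSheaf`), so `End(R_{Spec K}) ≃ End_R(R)` additively.
[cite: Milne2025, II Theorem 1.9] -/
noncomputable def endConstantSheafSelfPointAddEquiv :
    (constantSheafSelf (Spec (CommRingCat.of K)).smallEtaleTopology R ⟶
        constantSheafSelf (Spec (CommRingCat.of K)).smallEtaleTopology R) ≃+
      (ModuleCat.of R R ⟶ ModuleCat.of R R) :=
  (AddEquiv.mk'
    (Functor.FullyFaithful.ofFullyFaithful
      (constantSheaf (Spec (CommRingCat.of K)).smallEtaleTopology (ModuleCat.{u} R))).homEquiv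
    (fun _ _ => by rw [Functor.FullyFaithful.homEquiv_apply, Functor.FullyFaithful.homEquiv_apply,
      Functor.FullyFaithful.homEquiv_apply, Functor.map_add])).symm

/-- **`H⁰((Spec K)_ét, R) ≃ R`** (`K` separably closed): `H⁰ = Ext⁰(R, R) = End(R_{Spec K})`
(`Ext.addEquiv₀`) `= End_R(R)` (constant sheaves are fully faithful on a local site) `= R`
(`f ↦ f 1`). Milne III Example 1.7 (a) with `G = 1`: `H⁰(Spec K, F) = M^G = M`.
[cite: Milne2025, III Example 1.7 (a)] -/
noncomputable def etaleModCohomologyZeroPointAddEquiv :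
    etaleModCohomology (Spec (CommRingCat.of K)) R 0 ≃+ R :=
  Ext.addEquiv₀.trans <| (endConstantSheafSelfPointAddEquiv K R).trans <|
    (ModuleCat.homAddEquiv (M := ModuleCat.of R R) (N := ModuleCat.of R R)).trans
      (LinearMap.ringLmapEquivSelf R R R).toAddEquiv

/-- The isomorphism `H⁰((Spec K)_ét, R) ≃ R` sends the unit `1 ∈ H⁰` of the cup product to
`1 ∈ R`. [folklore] -/
theorem etaleModCohomologyZeroPointAddEquiv_one :
    etaleModCohomologyZeroPointAddEquiv K R
        (linearCohomology.one (Spec (CommRingCat.of K)).smallEtaleTopology R) = 1 := by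
  have h0 : Ext.addEquiv₀ (linearCohomology.one (Spec (CommRingCat.of K)).smallEtaleTopology R) =
      𝟙 _ :=
    (Ext.mk₀_bijective _ _).1 (by rw [Ext.mk₀_addEquiv₀_apply]; rfl)
  have h1 : endConstantSheafSelfPointAddEquiv K R (𝟙 _) = 𝟙 _ := by
    change (Functor.FullyFaithful.ofFullyFaithful
      (constantSheaf (Spec (CommRingCat.of K)).smallEtaleTopology (ModuleCat.{u} R))).homEquiv.symm
        (𝟙 _) = _
    rw [Functor.FullyFaithful.homEquiv_symm_apply]
    exact (Functor.FullyFaithful.ofFullyFaithful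
      (constantSheaf (Spec (CommRingCat.of K)).smallEtaleTopology (ModuleCat.{u} R))).preimage_id
  change LinearMap.ringLmapEquivSelf R R R (ModuleCat.homAddEquiv
    (endConstantSheafSelfPointAddEquiv K R
      (Ext.addEquiv₀ (linearCohomology.one (Spec (CommRingCat.of K)).smallEtaleTopology R)))) = 1
  rw [h0, h1]
  rfl

end Literature.AlgebraicGeometry.Motives
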